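import Summits.Ventures.GridStability.Models.InverterInstancesTwinV5s
import Summits.Ventures.GridStability.Models.GFMSMIBCCTLower

/-!
# GridStability/Models/GFMSMIBTwinCCTLower — a certified clearing time for the §V-consistent twin «GFM-SMIB-QoriaV5s»: every bolted fault of duration ≤ 0.7 s is recovered (energy route ∘ closed-form fault-on arc, 0 kit)

Cell `gridfusion` (LADDER-GRIDFUSION rung G3.a, successor lever «G3.a-cct» of memo §3 fold #40: «for GFM vs
infinite bus the fault-on arc is CLOSED FORM, so a certified CCT lower bound = closed form ∘ an existing ROA
certificate»; seat gridfusion-model-3 (g9); STAGED for the next wave per lead g8 RULING 9j (3) «no cct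
re-run on the twin this wave»). Worked kernel example of that lever on the twin record `gfmSmibQoriaV5s`
(InverterInstancesTwinV5s.lean: `ω_c = 5/2`, `k_i = ω_b′/25`, SMIB reading `M = 113/3550`, `D = 113/1420`,
`P_m′ = 8290560/16581121`, `P_M = 4`, `δˢ = arcsin(2072640/16581121)`):
* the ROA certificate is lit-6's ENERGY WELL read on model-1's records (`SMIB.energyWell_roa_Ici`,
  SMIBEnergyRoa.lean) with model-1's certified critical energy `6.4917 < V_cr(δˢ)` (SMIBEnergyRoaGFM.lean:
  `V_cr` depends on `P_m′, P_M, δˢ` only — identical for the twin, `twin_criticalEnergy_eq`);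
* the fault-on arc is the closed form of `InverterDroopFaultOnFiltered.lean` in SMIB coordinates:
  `X_F(T) = (δˢ + k_i p*′ (T − (1 − e^{−ω_c T})/ω_c), k_i p*′ (1 − e^{−ω_c T}))` (`twinFaultOnState`,
  `= toGridState (faultOnFiltered …)` by `twinFaultOnState_eq`);
* kernel numerals: `e^{−7/4} ∈ (0.1727, 0.1740)` (`Real.exp_bound` at `−7/8`, squared), the fault-on angle
  at `T ≤ 7/10` is `≤ 2.45` and the energy of the fault-on state is `≤ 6.4917` (potential part monotone on
  `[δˢ, π − δˢ]` = `qv4_potential_monotoneOn` of `GFMSMIBCCTLower.lean`, same `P_m′, δˢ`; kinetic part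
  `≤ M (k_i p*′ (1 − e^{−7/4}))²/2`).
DECIDING THEOREM `twin_cct_lower`: for every `0 ≤ T ≤ 7/10` and every solution `X` of the twin SMIB model on
`[0, ∞)` started at the fault-on state `X_F(T)`: the angle stays in `(−π − δˢ, π − δˢ)`, the energy stays
`≤ 6.4917`, and `X → (δˢ, 0)` — i.e. the critical clearing time of MODEL M_twin for a bolted terminal fault
from the operating point is AT LEAST `0.7 s` (an inner estimate; the energy route ignores damping).

THREE COLUMNS. CERTIFIED: the sentence above about M_twin (droop GFM ≡ SMIB, MV-6D + MV-P + MV-Ω +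
P-INV-7; bolted fault at the converter terminal `p_mes ≡ 0`; no limiter, NO virtual impedance).
VALIDATED / NOT LIKE-FOR-LIKE: the print's «`t_c = 498` ms with `H_VSC = 5` s» at `p* = 0.5`
[cite: Qoria2020, §V.3.6] [corpus:paper:galaxy-pdf-947812980 p0108 L19] is simulated WITH the virtual
impedance active after clearing (Fig. V-19/V-20), which lowers the admissible clearing angle — context
only, not a comparator of M_twin. Nothing here says a converter is stable.
-/

noncomputable section

open Real Set Filter Topology
open Summit.Ventures.GridStability.Models.AngleEnclosure

namespace Summit.Ventures.GridStability.Models.SMIB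

open InverterDroop

/-- The twin as an SMIB record, literally: `⟨M, D, P_m, P_C, P_M, γ⟩ = ⟨113/3550, 113/1420, p*′, 0, 4, 0⟩`. -/
def gfmQoriaV5sPhys : SMIB where
  M := (113 : ℝ) / 3550
  D := (113 : ℝ) / 1420
  Pm := (8290560 : ℝ) / 16581121
  PC := 0
  PM := 4
  γ := 0

/-- The two typed homes agree: model-3's twin converter record read through `toGridSMIB` IS
`gfmQoriaV5sPhys`. -/
theorem gfmQoriaV5sPhys_eq_toGridSMIB : gfmSmibQoriaV5s.toGridSMIB = gfmQoriaV5sPhys := by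
  simp only [ReducedParams.toGridSMIB, gfmSmibQoriaV5s, gfmQoriaV5sPhys, SMIB.mk.injEq]
  norm_num

/-- `δˢ` is an equilibrium angle of the twin (`4 s* = p*′`). -/
theorem gfmQoriaV5sPhys_isEquilibrium : gfmQoriaV5sPhys.IsEquilibrium deltaQV4 := by
  rw [isEquilibrium_iff]
  simp only [gfmQoriaV5sPhys, sub_zero, sin_deltaQV4, sQV4]
  norm_num

/-- lit-2 reading of the twin: `⟨113/3550, 113/1420, p*′, 4⟩`. -/
theorem gfmQoriaV5sPhys_toLit :
    gfmQoriaV5sPhys.toLit = ⟨113 / 3550, 113 / 1420, 8290560 / 16581121, 4⟩ := by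
  simp only [toLit, gfmQoriaV5sPhys, sub_zero]

/-- Same critical energy as the record of record (it depends on `P_m′, P_M, δˢ` only). -/
theorem twin_criticalEnergy_eq :
    gfmQoriaV5sPhys.toLit.criticalEnergy deltaQV4 = gfmQoriaV4Phys.toLit.criticalEnergy deltaQV4 := by
  rw [gfmQoriaV4Phys_criticalEnergy_eq, Literature.MathematicalPhysics.PowerSystems.SMIB.criticalEnergy,
    gfmQoriaV5sPhys_toLit, cos_deltaQV4]
  ring

/-- Certified `6.4917 < V_cr(δˢ)` for the twin (model-1's `gfmQoriaV4Phys_criticalEnergy_gt`, transported). -/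
theorem twin_criticalEnergy_gt : (64917 / 10000 : ℝ) < gfmQoriaV5sPhys.toLit.criticalEnergy deltaQV4 := by
  rw [twin_criticalEnergy_eq]; exact gfmQoriaV4Phys_criticalEnergy_gt

/-- `k_i p*′ = 11772595200/1873666673` (`≈ 6.2832` rad/s: the droop frequency deviation in rad/s). -/
def kpTwin : ℝ := 11772595200 / 1873666673

/-- `k_i p*′` of the twin record equals `kpTwin`. -/
theorem kpTwin_eq : gfmSmibQoriaV5s.ki * gfmSmibQoriaV5s.pref = kpTwin := by
  norm_num [gfmSmibQoriaV5s, kpTwin]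

/-- The fault-on state of the twin in SMIB coordinates after a bolted fault of duration `T` from
`(δˢ, 0)`: `(δˢ + k_i p*′ (T − (1 − e^{−(5/2)T})/(5/2)), k_i p*′ (1 − e^{−(5/2)T}))`. -/
def twinFaultOnState (T : ℝ) : ℝ × ℝ :=
  (deltaQV4 + kpTwin * (T - (1 - exp (-(5 / 2) * T)) / (5 / 2)), kpTwin * (1 - exp (-(5 / 2) * T)))

/-- The fault-on state IS model-3's closed-form fault-on motion read through `toGridState`
(`Ω = ω_b′(ω − ω_e)`). -/
theorem twinFaultOnState_eq (T : ℝ) :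
    twinFaultOnState T = gfmSmibQoriaV5s.toGridState (gfmSmibQoriaV5s.faultOnFiltered gfmSmibQoriaV4_δs T) := by
  rw [← deltaQV4_eq]
  simp only [twinFaultOnState, ReducedParams.toGridState, ReducedParams.faultOnFiltered, gfmSmibQoriaV5s,
    kpTwin, Prod.mk.injEq]
  constructor
  · norm_num
  · field_simp
    ring

/-! ## Kernel numerals -/

/-- `e^{−7/8} ∈ [0.4155, 0.4171]` (`Real.exp_bound`, six terms; float 0.41686). -/
theorem exp_neg_seven_eighths_bounds :
    (4155 / 10000 : ℝ) ≤ exp (-(7 / 8)) ∧ exp (-(7 / 8)) ≤ 4171 / 10000 := by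
  have h := Real.exp_bound (x := -(7 / 8 : ℝ)) (by rw [abs_le]; constructor <;> norm_num)
    (n := 6) (by norm_num)
  simp only [Finset.sum_range_succ, Finset.sum_range_zero, Nat.factorial, Nat.succ_eq_add_one] at h
  norm_num at h
  rw [abs_le] at h
  constructor <;> linarith [h.1, h.2]

/-- `e^{−7/4} ∈ [0.1726, 0.1740]` (square of the previous; float 0.17377). -/
theorem exp_neg_seven_quarters_bounds :
    (1726 / 10000 : ℝ) ≤ exp (-(7 / 4)) ∧ exp (-(7 / 4)) ≤ 1740 / 10000 := by
  obtain ⟨h1, h2⟩ := exp_neg_seven_eighths_bounds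
  have hsq : exp (-(7 / 4 : ℝ)) = exp (-(7 / 8)) * exp (-(7 / 8)) := by
    rw [← Real.exp_add]; norm_num
  have h0 : 0 ≤ exp (-(7 / 8 : ℝ)) := (exp_pos _).le
  rw [hsq]
  constructor <;> nlinarith

/-- The fault-on bracket `T − (1 − e^{−cT})/c` is non-decreasing in `T ≥ 0` (`c > 0`). -/
theorem faultOn_bracket_mono {c T T' : ℝ} (hc : 0 < c) (hT : 0 ≤ T) (hTT : T ≤ T') :
    T - (1 - exp (-c * T)) / c ≤ T' - (1 - exp (-c * T')) / c := by
  have hexp : exp (-c * T') = exp (-c * T) * exp (-(c * (T' - T))) := by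
    rw [← Real.exp_add]; ring_nf
  have hle1 : exp (-(c * (T' - T))) ≤ 1 := by
    rw [exp_le_one_iff]; nlinarith
  have hle : exp (-c * T) ≤ 1 := by
    rw [exp_le_one_iff]; nlinarith
  have h2 : 1 - exp (-(c * (T' - T))) ≤ c * (T' - T) := by
    have := add_one_le_exp (-(c * (T' - T))); linarith
  have key : exp (-c * T) - exp (-c * T') ≤ (T' - T) * c := by
    rw [hexp]
    have h1 : exp (-c * T) - exp (-c * T) * exp (-(c * (T' - T)))
        = exp (-c * T) * (1 - exp (-(c * (T' - T)))) := by ring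
    rw [h1]
    have h3 : 0 ≤ 1 - exp (-(c * (T' - T))) := by linarith
    calc exp (-c * T) * (1 - exp (-(c * (T' - T)))) ≤ 1 * (1 - exp (-(c * (T' - T)))) :=
          mul_le_mul_of_nonneg_right hle h3
      _ ≤ (T' - T) * c := by linarith [mul_comm c (T' - T)]
  have h4 : (1 - exp (-c * T')) / c - (1 - exp (-c * T)) / c ≤ T' - T := by
    rw [← sub_div, div_le_iff₀ hc]; linarith
  linarith

/-! ## The certified clearing time -/

/-- **Fault-on angle and energy at `T ≤ 7/10`.** For `0 ≤ T ≤ 7/10` the fault-on state `X_F(T)` has its angle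
in `[δˢ, 2.45]` and twin energy `≤ 6.4917`. -/
theorem twinFaultOnState_energy_le {T : ℝ} (hT0 : 0 ≤ T) (hT : T ≤ 7 / 10) :
    deltaQV4 ≤ (twinFaultOnState T).1 ∧ (twinFaultOnState T).1 ≤ 245 / 100 ∧
      gfmQoriaV5sPhys.energy deltaQV4 (twinFaultOnState T) ≤ 64917 / 10000 := by
  obtain ⟨hE1, hE2⟩ := exp_neg_seven_quarters_bounds
  have hδs1 := deltaQV4_gt
  have hδs2 := deltaQV4_lt
  have hkp : (0 : ℝ) < kpTwin := by norm_num [kpTwin]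
  -- bracket bounds: 0 ≤ T − (1 − e^{−2.5T})/2.5 ≤ 7/10 − (1 − e^{−7/4})/2.5
  have hbr0 : 0 ≤ T - (1 - exp (-(5 / 2) * T)) / (5 / 2) := by
    have h1 : 1 - exp (-((5 / 2) * T)) ≤ (5 / 2) * T := by
      have := add_one_le_exp (-((5 / 2) * T)); linarith
    rw [show -(5 / 2 : ℝ) * T = -((5 / 2) * T) by ring, sub_nonneg, div_le_iff₀ (by norm_num : (0:ℝ) < 5 / 2)]
    linarith
  have hbr1 : T - (1 - exp (-(5 / 2) * T)) / (5 / 2) ≤ 7 / 10 - (1 - exp (-(5 / 2) * (7 / 10))) / (5 / 2) :=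
    faultOn_bracket_mono (by norm_num) hT0 hT
  have h74 : exp (-(5 / 2 : ℝ) * (7 / 10)) = exp (-(7 / 4)) := by norm_num
  rw [h74] at hbr1
  -- angle bounds
  have hang_lo : deltaQV4 ≤ (twinFaultOnState T).1 := by
    simp only [twinFaultOnState]; nlinarith
  have hang_hi : (twinFaultOnState T).1 ≤ 245 / 100 := by
    simp only [twinFaultOnState]
    have : kpTwin * (T - (1 - exp (-(5 / 2) * T)) / (5 / 2))
        ≤ kpTwin * (7 / 10 - (1 - exp (-(7 / 4))) / (5 / 2)) := mul_le_mul_of_nonneg_left hbr1 hkp.le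
    norm_num [kpTwin] at this hδs2 ⊢
    nlinarith
  refine ⟨hang_lo, hang_hi, ?_⟩
  -- speed bound: 0 ≤ Ω_F ≤ kpTwin (1 − e^{−7/4})
  have hexpT : exp (-(7 / 4)) ≤ exp (-(5 / 2) * T) := by
    rw [exp_le_exp]; nlinarith
  have hexpT1 : exp (-(5 / 2) * T) ≤ 1 := by rw [exp_le_one_iff]; nlinarith
  have hΩ0 : 0 ≤ (twinFaultOnState T).2 := by
    simp only [twinFaultOnState]; exact mul_nonneg hkp.le (by linarith)
  have hΩ1 : (twinFaultOnState T).2 ≤ kpTwin * (1 - 1726 / 10000) := by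
    simp only [twinFaultOnState]; exact mul_le_mul_of_nonneg_left (by linarith) hkp.le
  -- potential bound via monotonicity on [δs, π − δs] at δ_up = 2.45
  have hwin_hi : (245 / 100 : ℝ) ≤ π - deltaQV4 := by linarith [pi_gt_d2]
  have hpot := qv4_potential_monotoneOn ⟨hang_lo, hang_hi.trans hwin_hi⟩ ⟨by linarith, hwin_hi⟩ hang_hi
  simp only at hpot
  -- cos lower bound at 2.45
  have hcos : cosLower4 (245 / 100) ≤ cos (245 / 100 : ℝ) :=
    cosLower4_le_cos _ (by norm_num [dbl]) (by norm_num [dbl]) (by norm_num [dbl]) (by norm_num [dbl])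
  norm_num [cosLower4, dbl] at hcos
  -- assemble the energy
  simp only [energy, gfmQoriaV5sPhys, sub_zero, cos_deltaQV4]
  norm_num [cQV4, kpTwin] at hΩ1 hpot ⊢
  nlinarith [hΩ0, hΩ1, hpot, hcos, sq_nonneg ((twinFaultOnState T).2), hδs1, hδs2]

/-- **Certified clearing time ≥ 0.7 s for MODEL M_twin («GFM-SMIB-QoriaV5s»).** For every fault duration
`0 ≤ T ≤ 7/10` s: every solution of the twin SMIB model on `[0, ∞)` that starts at the fault-on state
`X_F(T)` (bolted terminal fault from the operating point `(δˢ, 0)`, closed form) keeps its angle in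
`(−π − δˢ, π − δˢ)` and its energy `≤ 6.4917` for all `t ≥ 0` and tends to `(δˢ, 0)` — energy route
(lit-6 / model-1) ∘ closed-form fault-on arc (model-3), 0 kit. MODELLED: no virtual impedance, no limiter. -/
theorem twin_cct_lower {T : ℝ} (hT0 : 0 ≤ T) (hT : T ≤ 7 / 10) {X : ℝ → ℝ × ℝ}
    (hX : gfmQoriaV5sPhys.IsSolutionOn X (Ici 0)) (h0 : X 0 = twinFaultOnState T) :
    (∀ t, 0 ≤ t → (X t).1 ∈ Ioo (-π - deltaQV4) (π - deltaQV4) ∧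
        gfmQoriaV5sPhys.energy deltaQV4 (X t) ≤ 64917 / 10000) ∧
      Tendsto X atTop (𝓝 (deltaQV4, 0)) := by
  obtain ⟨hlo, hhi, hE⟩ := twinFaultOnState_energy_le hT0 hT
  refine energyWell_roa_Ici (p := gfmQoriaV5sPhys) rfl (by norm_num [gfmQoriaV5sPhys])
    (by norm_num [gfmQoriaV5sPhys]) (by norm_num [gfmQoriaV5sPhys]) gfmQoriaV5sPhys_isEquilibrium
    deltaQV4_pos.le deltaQV4_lt_pi_div_two twin_criticalEnergy_gt hX ?_ ?_
  · rw [h0]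
    constructor
    · linarith [deltaQV4_pos, pi_pos]
    · linarith [pi_gt_d2, deltaQV4_lt]
  · rw [h0]; exact hE

end Summit.Ventures.GridStability.Models.SMIB

end
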